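import Mathlib
import Summits.ValiantsHypothesis.ValiantsHypothesis.Theorems.BinomialElusiveBinomialCandidateCrossCapEliminant

/-!
# Crux `BinomialElusive.BinomialCandidate` (stmt-ValiantsHypothesis-7392), line `registered`,
# skeleton v5 — stub `stub_shallowCorankOne`, piece 3a: eliminant membership

Let `A := ℂ⟦W_0, …, W_{m-1}⟧` (`MvPowerSeries (Fin m) ℂ`), `𝔪 = (W_0, …, W_{m-1})` its
augmentation ideal, and `F₀, F₁ ∈ A⟦X⟧`.  Write `F₀ = Σ_j f_{0,j} X^j` and assume
`f_{0,j}(0) = 0` for `j < d` and `f_{0,d}(0) ≠ 0` (`d ≥ 1`).  Then `F₀` is a Weierstrass divisor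
of order `d` at `𝔪` (`A` is `𝔪`-adically complete, Mathlib), and Weierstrass division
(`PowerSeries.IsWeierstrassDivisorAt.isWeierstrassDivisionAt_div_mod`) of `X^j F₁`, `j < d`, by
`F₀` gives
`X^j F₁ = Q_j F₀ + Σ_{l<d} M_{lj} X^l`, `M_{lj} ∈ A`:
`M` is the `d × d` matrix of multiplication by `F₁` on the free `A`-module
`A⟦X⟧/(F₀) = ⊕_{l<d} A X^l`.  `corankOne_eliminantMembership` records these identities together
with the membership `det M ∈ (F₀, F₁)`, spelled `C (det M) = U F₀ + V F₁`.

The membership is pure commutative algebra (`CorankOneEliminant.det_mem_span_pair`): over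
`R := A⟦X⟧` put `N := F₁ · 1 - M` and `v := (X^l)_l` (a row vector with `v_0 = 1`); the division
identities say `v N = F₀ · (Q_j)_j`.  Multiplying by the adjugate, `det N · v = (v N) adj N` has
all entries in `(F₀)`, and its entry at `l = 0` is `det N`.  Modulo `(F₀, F₁)` the matrix `N`
reduces to `-M`, so `(-1)^d det M ≡ det N ≡ 0`.  This generalises the order-two computation of
`crossCap_eliminant` (template `…CrossCapEliminant.lean`) to every order `d`.
-/

-- layout Summits/ValiantsHypothesis/ValiantsHypothesis forces the duplicated namespace component
set_option linter.dupNamespace false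

noncomputable section

namespace Summit.ValiantsHypothesis.ValiantsHypothesis.Theorems.BinomialCandidateStubs

open scoped BigOperators

namespace CorankOneEliminant

variable {m : ℕ}

/-! ## `F₀` is a Weierstrass divisor of order `d` -/

section Weierstrass

variable (F₀ : PowerSeries (MvPowerSeries (Fin m) ℂ)) (d : ℕ)
  (h0 : ∀ j < d, MvPowerSeries.constantCoeff (PowerSeries.coeff j F₀) = 0)
  (hd : MvPowerSeries.constantCoeff (PowerSeries.coeff d F₀) ≠ 0)
include h0 hd

/-- The image of `F₀` in `(A/𝔪)⟦X⟧ = ℂ⟦X⟧` has order exactly `d`. -/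
theorem order_map_eq :
    (F₀.map (Ideal.Quotient.mk (Ideal.span (Set.range MvPowerSeries.X) :
      Ideal (MvPowerSeries (Fin m) ℂ)))).order = d := by
  refine PowerSeries.order_eq_nat.mpr ⟨?_, ?_⟩
  · rw [PowerSeries.coeff_map, Ne, Ideal.Quotient.eq_zero_iff_mem, CrossCap.mem_augIdeal_iff]
    exact hd
  · intro i hi
    rw [PowerSeries.coeff_map, Ideal.Quotient.eq_zero_iff_mem, CrossCap.mem_augIdeal_iff]
    exact h0 i hi

/-- Numeric form of `order_map_eq`  (so `F₀` is a Weierstrass divisor of order `d` at the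
augmentation ideal: its `X^d`-coefficient is a unit of `A`). -/
theorem order_toNat_eq :
    (F₀.map (Ideal.Quotient.mk (Ideal.span (Set.range MvPowerSeries.X) :
      Ideal (MvPowerSeries (Fin m) ℂ)))).order.toNat = d := by
  rw [order_map_eq F₀ d h0 hd, ENat.toNat_coe]

end Weierstrass

/-! ## Remainders as sums of monomials -/

/-- A polynomial of degree `< d`, as a power series, is `Σ_{l<d} C (r_l) X^l`. -/
theorem coe_eq_sum_of_degree_lt {A : Type*} [CommSemiring A] {d : ℕ} (r : Polynomial A)
    (h : r.degree < (d : WithBot ℕ)) :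
    (r : PowerSeries A) =
      ∑ l : Fin d, PowerSeries.C (r.coeff l) * PowerSeries.X ^ (l : ℕ) := by
  ext n
  simp only [Polynomial.coeff_coe, map_sum, PowerSeries.coeff_C_mul_X_pow]
  by_cases hn : n < d
  · rw [Finset.sum_eq_single (⟨n, hn⟩ : Fin d)]
    · simp
    · intro b _ hb
      exact if_neg fun h => hb (Fin.ext h.symm)
    · intro h
      exact absurd (Finset.mem_univ _) h
  · rw [Finset.sum_eq_zero]
    · exact Polynomial.coeff_eq_zero_of_degree_lt
        (lt_of_lt_of_le h (by exact_mod_cast not_lt.mp hn))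
    · intro x _
      exact if_neg fun h : n = (x : ℕ) => hn (h ▸ x.isLt)

/-! ## The adjugate trick -/

/-- **Adjugate trick.**  Over a commutative ring `R`, let `N₀` be a `d × d` matrix, `v` a vector
with `v i₀ = 1`, and suppose `v_j F₁ = Q_j F₀ + Σ_l (N₀)_{lj} v_l` for all `j`.  Then
`det N₀ ∈ (F₀, F₁)`: with `N := F₁ · 1 - N₀` one has `(v N)_j = Q_j F₀`, hence
`det N · v = (v N) adj N ∈ (F₀)^d`, so `det N ∈ (F₀)` (entry `i₀`), while `N ≡ -N₀` modulo
`(F₀, F₁)`. -/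
theorem det_mem_span_pair {R : Type*} [CommRing R] {d : ℕ} (F₀ F₁ : R)
    (N₀ : Matrix (Fin d) (Fin d) R) (Q v : Fin d → R) (i₀ : Fin d) (hv : v i₀ = 1)
    (h : ∀ j, v j * F₁ = Q j * F₀ + ∑ l, N₀ l j * v l) :
    N₀.det ∈ Ideal.span ({F₀, F₁} : Set R) := by
  set I : Ideal R := Ideal.span ({F₀, F₁} : Set R)
  have hF₀ : F₀ ∈ I := Ideal.subset_span (Set.mem_insert _ _)
  have hF₁ : F₁ ∈ I := Ideal.subset_span (Set.mem_insert_of_mem _ (Set.mem_singleton _))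
  -- the matrix `N = F₁ • 1 - N₀` of the linear relations
  set N : Matrix (Fin d) (Fin d) R := Matrix.diagonal (fun _ => F₁) - N₀ with hN
  have hvN : Matrix.vecMul v N = fun j => Q j * F₀ := by
    ext j
    have e : Matrix.vecMul v N₀ j = ∑ l, N₀ l j * v l := by
      simp only [Matrix.vecMul, dotProduct]
      exact Finset.sum_congr rfl fun l _ => mul_comm _ _
    rw [hN, Matrix.vecMul_sub, Pi.sub_apply, Matrix.vecMul_diagonal, h j, e]
    ring
  have h1 : Matrix.vecMul (Matrix.vecMul v N) N.adjugate = N.det • v := by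
    rw [Matrix.vecMul_vecMul, Matrix.mul_adjugate, Matrix.vecMul_smul, Matrix.vecMul_one]
  have h2 : N.det = (∑ j, Q j * N.adjugate j i₀) * F₀ := by
    have e := congrFun h1 i₀
    rw [Pi.smul_apply, smul_eq_mul, hv, mul_one, hvN] at e
    rw [← e]
    simp only [Matrix.vecMul, dotProduct, Finset.sum_mul]
    exact Finset.sum_congr rfl fun j _ => by ring
  have h3 : N.det ∈ I := h2 ▸ I.mul_mem_left _ hF₀
  -- reduction modulo `I`: `N ≡ -N₀`
  have h4 : (Ideal.Quotient.mk I).mapMatrix N = -(Ideal.Quotient.mk I).mapMatrix N₀ := by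
    have hF₁' : Ideal.Quotient.mk I F₁ = 0 := Ideal.Quotient.eq_zero_iff_mem.mpr hF₁
    ext i j
    simp only [RingHom.mapMatrix_apply, Matrix.map_apply, Matrix.neg_apply, hN,
      Matrix.sub_apply, Matrix.diagonal_apply, map_sub]
    split_ifs <;> simp [hF₁']
  have h5 : Ideal.Quotient.mk I N.det = (-1) ^ d * Ideal.Quotient.mk I N₀.det := by
    rw [RingHom.map_det, RingHom.map_det, h4, Matrix.det_neg, Fintype.card_fin]
  have h6 : Ideal.Quotient.mk I N₀.det = 0 := by
    have e : Ideal.Quotient.mk I N.det = 0 := Ideal.Quotient.eq_zero_iff_mem.mpr h3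
    rw [h5] at e
    exact (isUnit_one.neg.pow d).mul_right_eq_zero.mp e
  exact Ideal.Quotient.eq_zero_iff_mem.mp h6

end CorankOneEliminant

open CorankOneEliminant in
/-- **Eliminant membership** (piece 3a of the stub `stub_shallowCorankOne`).  For
`F₀, F₁ ∈ A⟦X⟧`, `A = ℂ⟦W_0, …, W_{m-1}⟧`, with `f_{0,j}(0) = 0` for `j < d` and `f_{0,d}(0) ≠ 0`
(`f_{0,j}` the `X^j`-coefficient of `F₀`, `d ≥ 1`), Weierstrass division of `X^j F₁` (`j < d`)
by `F₀` yields quotients `Q_j` and a `d × d` matrix `M` over `A` with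
`X^j F₁ = Q_j F₀ + Σ_{l<d} C (M_{lj}) X^l`, and `det M` lies in the ideal `(F₀, F₁)`:
`C (det M) = U F₀ + V F₁`. -/
theorem corankOne_eliminantMembership :
    ∀ (m d : ℕ) (F₀ F₁ : PowerSeries (MvPowerSeries (Fin m) ℂ)), 1 ≤ d →
      (∀ j < d, MvPowerSeries.constantCoeff (PowerSeries.coeff j F₀) = 0) →
      MvPowerSeries.constantCoeff (PowerSeries.coeff d F₀) ≠ 0 →
      ∃ (M : Matrix (Fin d) (Fin d) (MvPowerSeries (Fin m) ℂ))
        (Q : Fin d → PowerSeries (MvPowerSeries (Fin m) ℂ)) (U V : PowerSeries (MvPowerSeries (Fin m) ℂ)),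
        (∀ j : Fin d, PowerSeries.X ^ (j : ℕ) * F₁ =
          Q j * F₀ + ∑ l : Fin d, PowerSeries.C (M l j) * PowerSeries.X ^ (l : ℕ)) ∧
        PowerSeries.C M.det = U * F₀ + V * F₁ := by
  intro m d F₀ F₁ hd h0 hdd
  have hn := order_toNat_eq F₀ d h0 hdd
  -- `F₀` is a Weierstrass divisor (of order `d`) at the augmentation ideal
  have H : F₀.IsWeierstrassDivisorAt (Ideal.span (Set.range MvPowerSeries.X) :
      Ideal (MvPowerSeries (Fin m) ℂ)) := by
    unfold PowerSeries.IsWeierstrassDivisorAt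
    rw [hn, MvPowerSeries.isUnit_iff_constantCoeff]
    exact isUnit_iff_ne_zero.mpr hdd
  -- the Weierstrass division data: remainders `M` and quotients `Q`
  set M : Matrix (Fin d) (Fin d) (MvPowerSeries (Fin m) ℂ) :=
    Matrix.of fun l j => (H.mod (PowerSeries.X ^ (j : ℕ) * F₁)).coeff l
  set Q : Fin d → PowerSeries (MvPowerSeries (Fin m) ℂ) :=
    fun j => H.div (PowerSeries.X ^ (j : ℕ) * F₁)
  have hdiv : ∀ j : Fin d, PowerSeries.X ^ (j : ℕ) * F₁ =
      Q j * F₀ + ∑ l : Fin d, PowerSeries.C (M l j) * PowerSeries.X ^ (l : ℕ) := by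
    intro j
    obtain ⟨hdeg, hE⟩ := H.isWeierstrassDivisionAt_div_mod (PowerSeries.X ^ (j : ℕ) * F₁)
    rw [hn] at hdeg
    rw [hE, coe_eq_sum_of_degree_lt _ hdeg, mul_comm F₀]
    rfl
  -- membership of the determinant
  have hmem := det_mem_span_pair F₀ F₁ (M.map PowerSeries.C) Q
    (fun l => PowerSeries.X ^ (l : ℕ)) ⟨0, hd⟩ (pow_zero _)
    (fun j => by simpa only [Matrix.map_apply] using hdiv j)
  have hC : (M.map PowerSeries.C).det = PowerSeries.C M.det := by
    rw [RingHom.map_det PowerSeries.C M, RingHom.mapMatrix_apply]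
  rw [hC] at hmem
  obtain ⟨U, V, hUV⟩ := Ideal.mem_span_pair.mp hmem
  exact ⟨M, Q, U, V, hdiv, hUV.symm⟩

end Summit.ValiantsHypothesis.ValiantsHypothesis.Theorems.BinomialCandidateStubs

end
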